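import Summits.Parity.GeneralizedHardyLittlewood.Theorems.PrimeLevelFamEdgeMomentsBeyondDiagonalDiagRemFourFourEstimate
import Summits.Parity.GeneralizedHardyLittlewood.Theorems.PrimeLevelFamEdgeMomentsBeyondDiagonalDiagOrderFourFourOfR44
import Summits.Parity.GeneralizedHardyLittlewood.Theorems.PrimeLevelFamEdgeMomentsBeyondDiagonalDiagRungFourOfTarget44
import HarnessLib

/-!
# Route `PrimeLevelFamEdge`, crux K_A `MomentsBeyondDiagonal` (stmt-Parity-20007), line «petersson_layers» v4, stub `stub_diag`:
# **THE ORDER-`(4,4)` TARGET OF `stub_diag` IS UNCONDITIONAL, AND WITH IT RUNG `N = 4`: the diagonal main term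
# `diagPart q P Q Δ′` for EVERY admissible `P`, EVERY `Q` of degree `≤ 4` and every `Δ′ ∈ (1, 3/2]`, error `O(q̂ log⁻³q̂)`**

Composition of `…DiagRemFourFourEstimate.remainder_estimate₄₄` ((R₄₄), this lineage) with
`…DiagOrderFourFourOfR44.orderFourFour_target_of_remainder` ((Poly₄₄) discharged, lineage famedge-1 g16, p839686), and then of
the three rung-4 targets `(0,4)` (`…DiagOrderZeroFourHolds`, p837764), `(2,4)` (`…DiagOrderTwoFourHolds`, p838433), `(4,4)` (here)
through `…DiagRungFourOfTarget44.diagPart_asymp_of_natDegree_le_four_of_target44` (lineage famedge-2 frame `…DiagRungFourOfTargets`):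

* `orderFourFour_target` — **the order-`(4,4)` target of `…DiagOrderSelberg.subDiag_of_selbergOrderAsymptotics(_of_le)`
  (`τ₄₄(Δ′,P) = Δ′²·(Δ′⁶𝔎₄₄(1/Δ′,P))/(2(π²/6)²)`, `𝔎₄₄ = (π²/6)²(Φ₉/4608 − Ψ₇/448 + 9Ξ₅/640)`) on every window `(1, Δ]`,
  `Δ ≤ 3/2`, with NO hypothesis left**;
* `diagPart_asymp_of_natDegree_le_four` — **RUNG 4**: `‖diagPart q P Q Δ′ − 2ζ(2)²q̂/(Δ′²ℓ²)·(Q₀²·secondMomentForm Δ′ P 1 + 2Q₁²τ₁₁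
  + 4Q₀Q₂τ₀₂ + 2Q₂²τ₂₂ + 4Q₁Q₃τ₁₃ + 2Q₃²τ₃₃ + 4Q₀Q₄τ₀₄ + 4Q₂Q₄τ₂₄ + 2Q₄²τ₄₄)‖ ≤ C q̂ ℓ⁻³` for `deg Q ≤ 4`, `Δ′ ∈ (1, 3/2]`,
  all nine level-free functionals in closed form.

Rung currency: the diagonal evaluation of `stub_diag` now holds for all `Q` of degree `≤ 4` (rungs 1–4); `stub_diag` itself (every
`Q`) needs the generic order `(i,j)` (remainder side generic since famedge-1 g17: `…DiagRemMomentTailBoundPow` / `…DiagRemMomentsParam`;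
polynomial side: the engines of famedge-2); `stub_rung/core/band` (the off-diagonal heart, famE-02) and `stub_farP` are untouched.
Def-free; theorems only. Helper `--supports stmt-Parity-20007`; closes nothing; K_A, K_B and the Parity summit are NOT proved; nothing
about Landau–Siegel zeros.

## References
* E. Kowalski, P. Michel, J. VanderKam, J. reine angew. Math. 526 (2000), (23)–(28) pp. 13–15, Prop. 5.1 (31) p. 18.
  [cite: KowalskiMichelVanderKam2000, (23)–(28) pp. 13–15 — derivation (diagonal main term, order (4,4) and Q of degree ≤ 4)]
-/

noncomputable section

open scoped Real ArithmeticFunction.Moebius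
open Complex MeasureTheory Polynomial Finset ArithmeticFunction Set intervalIntegral
open Literature.NumberTheory.LFunctions Literature.NumberTheory.LFunctions.KMV2000

namespace Summit.Parity.GeneralizedHardyLittlewood.Theorems.MomentsBeyondDiagonal.DiagCorner

open Summit.Parity.GeneralizedHardyLittlewood.Theorems.PrimeLevelFamEdgeIdeaDeltas.PeterssonLayers (diagPart)
open Summit.Parity.GeneralizedHardyLittlewood.Theorems.MomentsBeyondDiagonal.DiagKernel (orderFourFour_target_of_remainder)

set_option maxHeartbeats 1600000 in
set_option maxRecDepth 16384 in
-- large statement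
/-- **THE ORDER-`(4,4)` TARGET OF `stub_diag`, UNCONDITIONAL** (window `(1, Δ]`, any `Δ ≤ 3/2`): (Poly₄₄) by
`…DiagDecorOrderFourFourPoly`, (R₄₄) by `…DiagRemFourFourEstimate.remainder_estimate₄₄`.
[cite: KowalskiMichelVanderKam2000, (23)–(28) and Prop. 5.1 — derivation (order-(4,4) piece of the diagonal, general Q)] -/
theorem orderFourFour_target {Δ : ℝ} (hΔ : Δ ≤ 3 / 2) :
    ∀ P : ℝ[X], KMV2000.Admissible P → ∀ Δ' : ℝ, 1 < Δ' → Δ' ≤ Δ →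
      ∃ C : ℝ, ∃ q₀ : ℕ, ∀ (q : ℕ) [NeZero q], q₀ ≤ q →
        |(Real.log (qhat q))⁻¹ ^ (4 + 4) * qhat q *
          (∑ c ∈ Icc 1 ⌊qhat q ^ Δ'⌋₊, ∑ g ∈ Icc 1 (⌊qhat q ^ Δ'⌋₊ / c), (μ g : ℝ) * c *
        ∑ k₁ ∈ Icc 1 (⌊qhat q ^ Δ'⌋₊ / (c * g)), ∑ k₂ ∈ Icc 1 (⌊qhat q ^ Δ'⌋₊ / (c * g)),
          ((μ (c * g * k₁) : ℝ) * ((psi (c * g * k₁))⁻¹ *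
              P.eval (Real.log (qhat q ^ Δ' / ((c * g * k₁ : ℕ) : ℝ)) / Real.log (qhat q ^ Δ'))) / ((c * g * k₁ : ℕ) : ℝ)) *
            ((μ (c * g * k₂) : ℝ) * ((psi (c * g * k₂))⁻¹ *
              P.eval (Real.log (qhat q ^ Δ' / ((c * g * k₂ : ℕ) : ℝ)) / Real.log (qhat q ^ Δ'))) / ((c * g * k₂ : ℕ) : ℝ)) *
            (∑ d ∈ k₁.divisors, ∑ e ∈ k₂.divisors,
              ∫ u₁ in Ioi (0 : ℝ),
                (Real.log (qhat q / ((k₁ / d * (g * e) : ℕ) : ℝ)) + Real.log u₁) ^ (4 : ℕ) *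
                ∫ u₂ in Ioi ((((k₁ / d * (g * e) * (g * d * (k₂ / e)) : ℕ) : ℝ) / qhat q ^ (2 : ℕ)) / u₁),
                  Real.exp (-(u₁ + u₂)) / (1 - Real.exp (-(u₁ + u₂))) ^ (2 : ℕ) *
                  (Real.log (qhat q / ((g * d * (k₂ / e) : ℕ) : ℝ)) + Real.log u₂) ^ (4 : ℕ))) -
          2 * (π ^ (2 : ℕ) / 6) ^ (2 : ℕ) * (qhat q / (Δ' ^ (2 : ℕ) * Real.log (qhat q) ^ (2 : ℕ))) *
            (Δ' ^ (2 : ℕ) * (Δ' ^ (6 : ℕ) * ((π ^ (2 : ℕ) / 6) ^ (2 : ℕ) * ((1 / 4608) * (∑ j ∈ Finset.range (9 + 1), ∑ i ∈ Finset.range (j + 1),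
            ((9 : ℕ).choose j : ℝ) * (j.choose i : ℝ) * 2 ^ (9 - j) *
              ∫ u in (0 : ℝ)..1, (((Polynomial.C (1 / Δ') - X) ^ (9 - j) * derivative (derivative (X ^ i * P))) *
                derivative (derivative (X ^ (j - i) * P))).eval u) +
          (-1 / 448) * (∑ j ∈ Finset.range (7 + 1), ∑ i ∈ Finset.range (j + 1),
            ((7 : ℕ).choose j : ℝ) * (j.choose i : ℝ) * 2 ^ (7 - j) *
              ∫ u in (0 : ℝ)..1, (((Polynomial.C (1 / Δ') - X) ^ (7 - j) * (-(2 : ℝ) • (X ^ i * P))) *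
                derivative (derivative (X ^ (j - i) * P))).eval u) +
          (9 / 640) * (∑ j ∈ Finset.range (5 + 1), ∑ i ∈ Finset.range (j + 1),
            ((5 : ℕ).choose j : ℝ) * (j.choose i : ℝ) * 2 ^ (5 - j) *
              ∫ u in (0 : ℝ)..1, (((Polynomial.C (1 / Δ') - X) ^ (5 - j) * (-(2 : ℝ) • (X ^ i * P))) *
                (-(2 : ℝ) • (X ^ (j - i) * P))).eval u)))) / (2 * (π ^ (2 : ℕ) / 6) ^ (2 : ℕ)))| ≤
          C * qhat q * (Real.log (qhat q))⁻¹ ^ (3 : ℕ) := by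
  refine orderFourFour_target_of_remainder (Δ := Δ) ?_
  obtain ⟨E₀₀, E₀₁, E₀₂, E₀₃, E₀₄, E₁₀, E₁₁, E₁₂, E₁₃, E₁₄, E₂₀, E₂₁, E₂₂, E₂₃, E₂₄, E₃₀, E₃₁, E₃₂, E₃₃, E₃₄, E₄₀, E₄₁, E₄₂, E₄₃, E₄₄, μ₂, μ₄, μ₆, μ₈, h⟩ :=
    remainder_estimate₄₄
  exact ⟨E₀₀, E₀₁, E₀₂, E₀₃, E₀₄, E₁₀, E₁₁, E₁₂, E₁₃, E₁₄, E₂₀, E₂₁, E₂₂, E₂₃, E₂₄, E₃₀, E₃₁, E₃₂, E₃₃, E₃₄, E₄₀, E₄₁, E₄₂, E₄₃, E₄₄, μ₂, μ₄, μ₆, μ₈,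
    fun P hP Δ' h1 h2 ↦ h P hP Δ' h1 (h2.trans hΔ)⟩

set_option maxHeartbeats 6400000 in
set_option maxRecDepth 16384 in
-- large statement (nine closed-form functionals, exponent literals ascribed); one large instantiation of the rung-4 frame
/-- **RUNG `N = 4` OF `stub_diag`, UNCONDITIONAL**: the diagonal main term for every admissible `P`, every `Q` of degree `≤ 4`
and every `Δ′ ∈ (1, 3/2]` (see the module docstring).
[cite: KowalskiMichelVanderKam2000, (23)–(28) pp. 13–15, Prop. 5.1 (31) — derivation (diagonal main term, Q of degree ≤ 4)] -/
theorem diagPart_asymp_of_natDegree_le_four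
    {P Q : ℝ[X]} (hP : KMV2000.Admissible P) (hQ : Q.natDegree ≤ 4) {Δ' : ℝ} (h1 : 1 < Δ') (h32 : Δ' ≤ 3 / 2) :
    ∃ C : ℝ, ∃ q₀ : ℕ, ∀ (q : ℕ) [NeZero q], q₀ ≤ q →
      ‖diagPart q P Q Δ' -
          ((2 * riemannZeta 2 ^ (2 : ℕ) *
              ((qhat q / (Δ' ^ (2 : ℕ) * Real.log (qhat q) ^ (2 : ℕ)) : ℝ) : ℂ)) *
            ((Q.coeff 0 ^ (2 : ℕ) * KMV2000.secondMomentForm Δ' P 1 +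
              2 * Q.coeff 1 ^ (2 : ℕ) *
                (Δ' ^ (2 : ℕ) * ((π ^ (2 : ℕ) / 6) ^ (2 : ℕ) *
              ((∑ j ∈ Finset.range (3 + 1), ∑ i ∈ Finset.range (j + 1),
                  ((3 : ℕ).choose j : ℝ) * (j.choose i : ℝ) * 2 ^ (3 - j) *
                    ∫ u in (0 : ℝ)..1, (((Polynomial.C (1 / Δ') - X) ^ (3 - j) *
                      derivative (derivative (X ^ i * P))) * derivative (derivative (X ^ (j - i) * P))).eval u) / 24 -
                (∑ j ∈ Finset.range (1 + 1), ∑ i ∈ Finset.range (j + 1),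
                  ((1 : ℕ).choose j : ℝ) * (j.choose i : ℝ) * 2 ^ (1 - j) *
                    ∫ u in (0 : ℝ)..1, (((Polynomial.C (1 / Δ') - X) ^ (1 - j) * (-(2 : ℝ) • (X ^ i * P))) *
                      derivative (derivative (X ^ (j - i) * P))).eval u) / 4)) / (2 * (π ^ (2 : ℕ) / 6) ^ (2 : ℕ))) +
              4 * (Q.coeff 0 * Q.coeff 2) *
                (Δ' ^ (2 : ℕ) * ((π ^ (2 : ℕ) / 6) ^ (2 : ℕ) *
              ((∑ j ∈ Finset.range (3 + 1), ∑ i ∈ Finset.range (j + 1),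
                  ((3 : ℕ).choose j : ℝ) * (j.choose i : ℝ) * 2 ^ (3 - j) *
                    ∫ u in (0 : ℝ)..1, (((Polynomial.C (1 / Δ') - X) ^ (3 - j) *
                      derivative (derivative (X ^ i * P))) * derivative (derivative (X ^ (j - i) * P))).eval u) / 24 +
                (∑ j ∈ Finset.range (1 + 1), ∑ i ∈ Finset.range (j + 1),
                  ((1 : ℕ).choose j : ℝ) * (j.choose i : ℝ) * 2 ^ (1 - j) *
                    ∫ u in (0 : ℝ)..1, (((Polynomial.C (1 / Δ') - X) ^ (1 - j) * (-(2 : ℝ) • (X ^ i * P))) *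
                      derivative (derivative (X ^ (j - i) * P))).eval u) / 4)) / (2 * (π ^ (2 : ℕ) / 6) ^ (2 : ℕ))) +
              2 * Q.coeff 2 ^ (2 : ℕ) *
                (Δ' ^ (2 : ℕ) * (Δ' ^ (2 : ℕ) * ((π ^ (2 : ℕ) / 6) ^ (2 : ℕ) * ((∑ j ∈ Finset.range (5 + 1), ∑ i ∈ Finset.range (j + 1),
            ((5 : ℕ).choose j : ℝ) * (j.choose i : ℝ) * 2 ^ (5 - j) *
              ∫ u in (0 : ℝ)..1, (((Polynomial.C (1 / Δ') - X) ^ (5 - j) * derivative (derivative (X ^ i * P))) *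
                derivative (derivative (X ^ (j - i) * P))).eval u) / 160 -
          (∑ j ∈ Finset.range (3 + 1), ∑ i ∈ Finset.range (j + 1),
            ((3 : ℕ).choose j : ℝ) * (j.choose i : ℝ) * 2 ^ (3 - j) *
              ∫ u in (0 : ℝ)..1, (((Polynomial.C (1 / Δ') - X) ^ (3 - j) * (-(2 : ℝ) • (X ^ i * P))) *
                derivative (derivative (X ^ (j - i) * P))).eval u) / 24 +
          3 / 16 * (∑ j ∈ Finset.range (1 + 1), ∑ i ∈ Finset.range (j + 1),
            ((1 : ℕ).choose j : ℝ) * (j.choose i : ℝ) * 2 ^ (1 - j) *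
              ∫ u in (0 : ℝ)..1, (((Polynomial.C (1 / Δ') - X) ^ (1 - j) * (-(2 : ℝ) • (X ^ i * P))) *
                (-(2 : ℝ) • (X ^ (j - i) * P))).eval u)))) / (2 * (π ^ (2 : ℕ) / 6) ^ (2 : ℕ))) +
              4 * (Q.coeff 1 * Q.coeff 3) *
                (Δ' ^ (2 : ℕ) * (Δ' ^ (2 : ℕ) * ((π ^ (2 : ℕ) / 6) ^ (2 : ℕ) * ((∑ j ∈ Finset.range (5 + 1), ∑ i ∈ Finset.range (j + 1),
            ((5 : ℕ).choose j : ℝ) * (j.choose i : ℝ) * 2 ^ (5 - j) *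
              ∫ u in (0 : ℝ)..1, (((Polynomial.C (1 / Δ') - X) ^ (5 - j) * derivative (derivative (X ^ i * P))) *
                derivative (derivative (X ^ (j - i) * P))).eval u) / 160 -
          3 / 16 * (∑ j ∈ Finset.range (1 + 1), ∑ i ∈ Finset.range (j + 1),
            ((1 : ℕ).choose j : ℝ) * (j.choose i : ℝ) * 2 ^ (1 - j) *
              ∫ u in (0 : ℝ)..1, (((Polynomial.C (1 / Δ') - X) ^ (1 - j) * (-(2 : ℝ) • (X ^ i * P))) *
                (-(2 : ℝ) • (X ^ (j - i) * P))).eval u)))) / (2 * (π ^ (2 : ℕ) / 6) ^ (2 : ℕ))) +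
              2 * Q.coeff 3 ^ (2 : ℕ) *
                (Δ' ^ (2 : ℕ) * (Δ' ^ (4 : ℕ) * ((π ^ (2 : ℕ) / 6) ^ (2 : ℕ) * ((1 / 896) * (∑ j ∈ Finset.range (7 + 1), ∑ i ∈ Finset.range (j + 1),
            ((7 : ℕ).choose j : ℝ) * (j.choose i : ℝ) * 2 ^ (7 - j) *
              ∫ u in (0 : ℝ)..1, (((Polynomial.C (1 / Δ') - X) ^ (7 - j) * derivative (derivative (X ^ i * P))) *
                derivative (derivative (X ^ (j - i) * P))).eval u) +
          (-3 / 320) * (∑ j ∈ Finset.range (5 + 1), ∑ i ∈ Finset.range (j + 1),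
            ((5 : ℕ).choose j : ℝ) * (j.choose i : ℝ) * 2 ^ (5 - j) *
              ∫ u in (0 : ℝ)..1, (((Polynomial.C (1 / Δ') - X) ^ (5 - j) * (-(2 : ℝ) • (X ^ i * P))) *
                derivative (derivative (X ^ (j - i) * P))).eval u) +
          (3 / 64) * (∑ j ∈ Finset.range (3 + 1), ∑ i ∈ Finset.range (j + 1),
            ((3 : ℕ).choose j : ℝ) * (j.choose i : ℝ) * 2 ^ (3 - j) *
              ∫ u in (0 : ℝ)..1, (((Polynomial.C (1 / Δ') - X) ^ (3 - j) * (-(2 : ℝ) • (X ^ i * P))) *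
                (-(2 : ℝ) • (X ^ (j - i) * P))).eval u)))) / (2 * (π ^ (2 : ℕ) / 6) ^ (2 : ℕ))) +
              4 * (Q.coeff 0 * Q.coeff 4) *
                (Δ' ^ (2 : ℕ) * (Δ' ^ (2 : ℕ) * ((π ^ (2 : ℕ) / 6) ^ (2 : ℕ) * ((1 / 160) * (∑ j ∈ Finset.range (5 + 1), ∑ i ∈ Finset.range (j + 1),
            ((5 : ℕ).choose j : ℝ) * (j.choose i : ℝ) * 2 ^ (5 - j) *
              ∫ u in (0 : ℝ)..1, (((Polynomial.C (1 / Δ') - X) ^ (5 - j) * derivative (derivative (X ^ i * P))) *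
                derivative (derivative (X ^ (j - i) * P))).eval u) +
          (1 / 8) * (∑ j ∈ Finset.range (3 + 1), ∑ i ∈ Finset.range (j + 1),
            ((3 : ℕ).choose j : ℝ) * (j.choose i : ℝ) * 2 ^ (3 - j) *
              ∫ u in (0 : ℝ)..1, (((Polynomial.C (1 / Δ') - X) ^ (3 - j) * (-(2 : ℝ) • (X ^ i * P))) *
                derivative (derivative (X ^ (j - i) * P))).eval u) +
          (3 / 16) * (∑ j ∈ Finset.range (1 + 1), ∑ i ∈ Finset.range (j + 1),
            ((1 : ℕ).choose j : ℝ) * (j.choose i : ℝ) * 2 ^ (1 - j) *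
              ∫ u in (0 : ℝ)..1, (((Polynomial.C (1 / Δ') - X) ^ (1 - j) * (-(2 : ℝ) • (X ^ i * P))) *
                (-(2 : ℝ) • (X ^ (j - i) * P))).eval u)))) / (2 * (π ^ (2 : ℕ) / 6) ^ (2 : ℕ))) +
              4 * (Q.coeff 2 * Q.coeff 4) *
                (Δ' ^ (2 : ℕ) * (Δ' ^ (4 : ℕ) * ((π ^ (2 : ℕ) / 6) ^ (2 : ℕ) * ((1 / 896) * (∑ j ∈ Finset.range (7 + 1), ∑ i ∈ Finset.range (j + 1),
            ((7 : ℕ).choose j : ℝ) * (j.choose i : ℝ) * 2 ^ (7 - j) *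
              ∫ u in (0 : ℝ)..1, (((Polynomial.C (1 / Δ') - X) ^ (7 - j) * derivative (derivative (X ^ i * P))) *
                derivative (derivative (X ^ (j - i) * P))).eval u) +
          (-1 / 320) * (∑ j ∈ Finset.range (5 + 1), ∑ i ∈ Finset.range (j + 1),
            ((5 : ℕ).choose j : ℝ) * (j.choose i : ℝ) * 2 ^ (5 - j) *
              ∫ u in (0 : ℝ)..1, (((Polynomial.C (1 / Δ') - X) ^ (5 - j) * (-(2 : ℝ) • (X ^ i * P))) *
                derivative (derivative (X ^ (j - i) * P))).eval u) +
          (-1 / 64) * (∑ j ∈ Finset.range (3 + 1), ∑ i ∈ Finset.range (j + 1),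
            ((3 : ℕ).choose j : ℝ) * (j.choose i : ℝ) * 2 ^ (3 - j) *
              ∫ u in (0 : ℝ)..1, (((Polynomial.C (1 / Δ') - X) ^ (3 - j) * (-(2 : ℝ) • (X ^ i * P))) *
                (-(2 : ℝ) • (X ^ (j - i) * P))).eval u)))) / (2 * (π ^ (2 : ℕ) / 6) ^ (2 : ℕ))) +
              2 * Q.coeff 4 ^ (2 : ℕ) *
                (Δ' ^ (2 : ℕ) * (Δ' ^ (6 : ℕ) * (((π ^ (2 : ℕ) / 6) ^ (2 : ℕ) * ((1 / 4608) * (∑ j ∈ Finset.range (9 + 1), ∑ i ∈ Finset.range (j + 1),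
            ((9 : ℕ).choose j : ℝ) * (j.choose i : ℝ) * 2 ^ (9 - j) *
              ∫ u in (0 : ℝ)..1, (((Polynomial.C (1 / Δ') - X) ^ (9 - j) * derivative (derivative (X ^ i * P))) *
                derivative (derivative (X ^ (j - i) * P))).eval u) +
          (-1 / 448) * (∑ j ∈ Finset.range (7 + 1), ∑ i ∈ Finset.range (j + 1),
            ((7 : ℕ).choose j : ℝ) * (j.choose i : ℝ) * 2 ^ (7 - j) *
              ∫ u in (0 : ℝ)..1, (((Polynomial.C (1 / Δ') - X) ^ (7 - j) * (-(2 : ℝ) • (X ^ i * P))) *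
                derivative (derivative (X ^ (j - i) * P))).eval u) +
          (9 / 640) * (∑ j ∈ Finset.range (5 + 1), ∑ i ∈ Finset.range (j + 1),
            ((5 : ℕ).choose j : ℝ) * (j.choose i : ℝ) * 2 ^ (5 - j) *
              ∫ u in (0 : ℝ)..1, (((Polynomial.C (1 / Δ') - X) ^ (5 - j) * (-(2 : ℝ) • (X ^ i * P))) *
                (-(2 : ℝ) • (X ^ (j - i) * P))).eval u))))) / (2 * (π ^ (2 : ℕ) / 6) ^ (2 : ℕ))) : ℝ) : ℂ))‖ ≤
        C * qhat q * (Real.log (qhat q))⁻¹ ^ (3 : ℕ) := by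
  obtain ⟨𝔎₄₄, hK₄₄⟩ : ∃ 𝔎 : ℝ → ℝ[X] → ℝ, 𝔎 = fun (lam : ℝ) (P : ℝ[X]) ↦ ((π ^ (2 : ℕ) / 6) ^ (2 : ℕ) * ((1 / 4608) * (∑ j ∈ Finset.range (9 + 1), ∑ i ∈ Finset.range (j + 1),
            ((9 : ℕ).choose j : ℝ) * (j.choose i : ℝ) * 2 ^ (9 - j) *
              ∫ u in (0 : ℝ)..1, (((Polynomial.C lam - X) ^ (9 - j) * derivative (derivative (X ^ i * P))) *
                derivative (derivative (X ^ (j - i) * P))).eval u) +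
          (-1 / 448) * (∑ j ∈ Finset.range (7 + 1), ∑ i ∈ Finset.range (j + 1),
            ((7 : ℕ).choose j : ℝ) * (j.choose i : ℝ) * 2 ^ (7 - j) *
              ∫ u in (0 : ℝ)..1, (((Polynomial.C lam - X) ^ (7 - j) * (-(2 : ℝ) • (X ^ i * P))) *
                derivative (derivative (X ^ (j - i) * P))).eval u) +
          (9 / 640) * (∑ j ∈ Finset.range (5 + 1), ∑ i ∈ Finset.range (j + 1),
            ((5 : ℕ).choose j : ℝ) * (j.choose i : ℝ) * 2 ^ (5 - j) *
              ∫ u in (0 : ℝ)..1, (((Polynomial.C lam - X) ^ (5 - j) * (-(2 : ℝ) • (X ^ i * P))) *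
                (-(2 : ℝ) • (X ^ (j - i) * P))).eval u))) := ⟨_, rfl⟩
  have e₄₄ : ∀ (Δ' : ℝ) (P : ℝ[X]), 𝔎₄₄ (1 / Δ') P = ((π ^ (2 : ℕ) / 6) ^ (2 : ℕ) * ((1 / 4608) * (∑ j ∈ Finset.range (9 + 1), ∑ i ∈ Finset.range (j + 1),
            ((9 : ℕ).choose j : ℝ) * (j.choose i : ℝ) * 2 ^ (9 - j) *
              ∫ u in (0 : ℝ)..1, (((Polynomial.C (1 / Δ') - X) ^ (9 - j) * derivative (derivative (X ^ i * P))) *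
                derivative (derivative (X ^ (j - i) * P))).eval u) +
          (-1 / 448) * (∑ j ∈ Finset.range (7 + 1), ∑ i ∈ Finset.range (j + 1),
            ((7 : ℕ).choose j : ℝ) * (j.choose i : ℝ) * 2 ^ (7 - j) *
              ∫ u in (0 : ℝ)..1, (((Polynomial.C (1 / Δ') - X) ^ (7 - j) * (-(2 : ℝ) • (X ^ i * P))) *
                derivative (derivative (X ^ (j - i) * P))).eval u) +
          (9 / 640) * (∑ j ∈ Finset.range (5 + 1), ∑ i ∈ Finset.range (j + 1),
            ((5 : ℕ).choose j : ℝ) * (j.choose i : ℝ) * 2 ^ (5 - j) *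
              ∫ u in (0 : ℝ)..1, (((Polynomial.C (1 / Δ') - X) ^ (5 - j) * (-(2 : ℝ) • (X ^ i * P))) *
                (-(2 : ℝ) • (X ^ (j - i) * P))).eval u))) := fun _ _ ↦ by
    rw [hK₄₄]
  have h44 : ∀ P : ℝ[X], KMV2000.Admissible P → ∀ Δ' : ℝ, 1 < Δ' → Δ' ≤ 3 / 2 →
      ∃ C : ℝ, ∃ q₀ : ℕ, ∀ (q : ℕ) [NeZero q], q₀ ≤ q →
        |(Real.log (qhat q))⁻¹ ^ (4 + 4) * qhat q *
          (∑ c ∈ Icc 1 ⌊qhat q ^ Δ'⌋₊, ∑ g ∈ Icc 1 (⌊qhat q ^ Δ'⌋₊ / c), (μ g : ℝ) * c *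
        ∑ k₁ ∈ Icc 1 (⌊qhat q ^ Δ'⌋₊ / (c * g)), ∑ k₂ ∈ Icc 1 (⌊qhat q ^ Δ'⌋₊ / (c * g)),
          ((μ (c * g * k₁) : ℝ) * ((psi (c * g * k₁))⁻¹ *
              P.eval (Real.log (qhat q ^ Δ' / ((c * g * k₁ : ℕ) : ℝ)) / Real.log (qhat q ^ Δ'))) / ((c * g * k₁ : ℕ) : ℝ)) *
            ((μ (c * g * k₂) : ℝ) * ((psi (c * g * k₂))⁻¹ *
              P.eval (Real.log (qhat q ^ Δ' / ((c * g * k₂ : ℕ) : ℝ)) / Real.log (qhat q ^ Δ'))) / ((c * g * k₂ : ℕ) : ℝ)) *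
            (∑ d ∈ k₁.divisors, ∑ e ∈ k₂.divisors,
              ∫ u₁ in Ioi (0 : ℝ),
                (Real.log (qhat q / ((k₁ / d * (g * e) : ℕ) : ℝ)) + Real.log u₁) ^ (4 : ℕ) *
                ∫ u₂ in Ioi ((((k₁ / d * (g * e) * (g * d * (k₂ / e)) : ℕ) : ℝ) / qhat q ^ (2 : ℕ)) / u₁),
                  Real.exp (-(u₁ + u₂)) / (1 - Real.exp (-(u₁ + u₂))) ^ (2 : ℕ) *
                  (Real.log (qhat q / ((g * d * (k₂ / e) : ℕ) : ℝ)) + Real.log u₂) ^ (4 : ℕ))) -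
          2 * (π ^ (2 : ℕ) / 6) ^ (2 : ℕ) * (qhat q / (Δ' ^ (2 : ℕ) * Real.log (qhat q) ^ (2 : ℕ))) *
            (Δ' ^ (2 : ℕ) * (Δ' ^ (6 : ℕ) * 𝔎₄₄ (1 / Δ') P) / (2 * (π ^ (2 : ℕ) / 6) ^ (2 : ℕ)))| ≤
          C * qhat q * (Real.log (qhat q))⁻¹ ^ (3 : ℕ) := fun P' hP' Δ'' h1' h2' ↦ by
    rw [e₄₄ Δ'' P']
    exact orderFourFour_target le_rfl P' hP' Δ'' h1' h2'
  have h := diagPart_asymp_of_natDegree_le_four_of_target44 le_rfl 𝔎₄₄ h44 hP hQ h1 h32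
  rw [e₄₄ Δ' P] at h
  exact h

end Summit.Parity.GeneralizedHardyLittlewood.Theorems.MomentsBeyondDiagonal.DiagCorner

end
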